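/-
COR-CM (cell pub-hodgecm2, stage 2 of the Hodge ladder) — count-neutral KERNEL CENSUS TRANSPORT, INTRINSIC FORM, degree 12, type `ℤ/6×ℤ/2`
(seat prover-pub-hodgecm2-b23-g33-0, binder prover b23, gen 33; claim INT2-INTRINSIC addendum DEG12-GENERATORS; sequel of
`Census/DuodecicFaceTransportC6C2.lean` and `CorCM/FaceCensusGroupDictionary.lean`). Theorems only; no definition, no named fact, nothing
asserted; the census dictionary (`enum`, `group_spec` of `Census/DuodecicFaceGeneratorsC6C2.lean`) is consumed BY NAME; `Interfaces.lean` (C1), every E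
term, B01 and `Transposition/*` are untouched. HONEST FRAMING (COORDINATOR RULING — HODGE FRAMING CORRECTION, 2026-08-21T11:55:35Z): `HC_CM` is
NOT proved, here or anywhere in the tree. Every closing theorem below is CONDITIONAL on face-period witnesses (for ONE field, on the listed faces);
no period is proved here.
T5 (coordinator ruling 15:33:56Z (3), lead staging l.4095): the DICTIONARY binders of `…_duodecicC6C2_aut` (`ε`, `hε`, `c`, `hc`, `ε c = Γ.conj`) are
DISCHARGED here from ONE isomorphism `e : Gal(K/ℚ) ≃* Multiplicative (ZMod 6 × ZMod 2)` with the name of complex conjugation (normalisable: `FaceCensus.exists_mulEquiv_conj_zmod_six_two`); the face-reading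
binders are inhabited in the kernel (`exists_face_<code>_of_mulEquiv`); the only remaining hypotheses are the period witnesses on the listed faces =
instances of the crux (`FacePeriodExists` / B01-S), against which the tree has no `¬` theorem on the universe of record — no contradiction derivable;
checker: self (prover-pub-hodgecm2-b23-g33-0), 2026-08-21.
-/
import Summits.HodgeConjecture.CorCM.FaceCensusGroupDictionary
import Summits.HodgeConjecture.CorCM.Census.DuodecicFaceTransportC6C2
import Summits.HodgeConjecture.CorCM.Census.OcticFaceTransportIntrinsicAbelian
import Mathlib.Data.ZMod.Basic
import HarnessLib

/-!
# Galois CM fields of degree 12 with group `ℤ/6×ℤ/2`: field closure from an isomorphism with the Mathlib group (intrinsic form)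

Fields of this type: the dodecic abelian non-cyclic Galois CM fields, e.g. `ℚ(ζ₂₁)`, `ℚ(ζ₂₈)`, `ℚ(ζ₃₆)`, `ℚ(ζ₇)·k`, `ℚ(ζ₉)·k`.  The automorphism-form field-closure theorem `…_duodecicC6C2_aut` (`Census/DuodecicFaceTransportC6C2.lean`) takes an
enumeration `ε : Aut(K) ≃ Fin 12` multiplicative for the census table, the conjugation automorphism `c` at `σ₀` and `ε c = Γ.conj` as
hypotheses.  Here all of it is derived from ONE isomorphism `e : Gal(K/ℚ) ≃* Multiplicative (ZMod 6 × ZMod 2)` (`FaceCensus.exists_enum_of_groupEnum` over the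
certified dictionary `group_spec`) together with the position of complex conjugation, `e⁻¹(3,0)` — the three involutions of `ℤ/6×ℤ/2` are exchanged by automorphisms, so EVERY isomorphism can be so normalised (`FaceCensus.exists_mulEquiv_conj_zmod_six_two`, §end).  The 6 generating
faces of the census (minimal number of face ORBITS for this type by the exact model, kit job j137010) then read as explicit group data
(`…_mulEquiv`), and they exist for every such `K`, `e`, `σ₀` (`exists_face_<code>_of_mulEquiv`).  `HC_CM` is NOT proved and nothing here
produces a period.

References: [cite: Pohlmann1968, Thm. 1]; [cite: Milne1999LefschetzClasses, Thm. 3.2 and Cor. 4.5];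
[cite: Shimura1998, §6.2 Theorem 3 and §6.1 Corollary of Theorem 2 (pp. 41–43)]; [cite: MumfordAV1970, §19 Thm. 1 and p. 169].
-/

noncomputable section

open CategoryTheory NumberField NumberField.ComplexEmbedding
open Literature.AlgebraicGeometry Literature.AlgebraicGeometry.Motives Literature.AlgebraicGeometry.HodgeTheory
open Literature.AlgebraicGeometry.ComplexMultiplication Literature.AlgebraicGeometry.Milne1999
open Literature.NumberTheory.Automorphic
open Literature.NumberTheory.Automorphic.PicardCM
open Summit.HodgeConjecture.CorCM.Domination

namespace Summit.HodgeConjecture.CorCM.DuodecicFaceTransport.C6C2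

open Summit.HodgeConjecture.CorCM.Census.FaceSquaresModel (mem)
open Summit.HodgeConjecture.CorCM.Census.DuodecicFaceGeneratorsC6C2 (Γ enum group_spec)

/-- **The dictionary from an isomorphism with `ZMod 6 × ZMod 2`, type `ℤ/6×ℤ/2`.**  `K` a Galois CM field, `e : Gal(K/ℚ) ≃* Multiplicative (ZMod 6 × ZMod 2)`
such that `e⁻¹(3,0)` induces complex conjugation at `σ₀` (every isomorphism can be so normalised: `exists_mulEquiv_conj` below).  Then there is an
enumeration `ε : Aut(K) ≃ Fin 12`, multiplicative for the Cayley table of `Census/DuodecicFaceGeneratorsC6C2.lean`, reading `e` through the additive `enum`, with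
`ε (e⁻¹(3,0)) = Γ.conj`. [folklore] -/
theorem exists_autEnum_of_mulEquiv (K : CMField) [IsGalois ℚ K] (e : ((K : Type) ≃ₐ[ℚ] (K : Type)) ≃* Multiplicative (ZMod 6 × ZMod 2)) :
    ∃ ε : ((K : Type) ≃ₐ[ℚ] (K : Type)) ≃ Fin 12,
      (∀ x y : ((K : Type) ≃ₐ[ℚ] (K : Type)), ε (x * y) = Γ.mul (ε x) (ε y)) ∧ (∀ h : ((K : Type) ≃ₐ[ℚ] (K : Type)), enum (ε h) = Multiplicative.toAdd (e h)) ∧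
      (∀ (h : ((K : Type) ≃ₐ[ℚ] (K : Type))) (i : Fin 12), Multiplicative.toAdd (e h) = enum i → ε h = i) ∧
      ε (e.symm (Multiplicative.ofAdd ((3 : ZMod 6), (0 : ZMod 2)))) = Γ.conj := by
  obtain ⟨ε, hε, hread⟩ := FaceCensus.exists_enum_of_groupEnum Γ (· + ·) enum group_spec.2.1 group_spec.2.2.1
    (by simp) (fun h => Multiplicative.toAdd (e h)) (Multiplicative.toAdd.bijective.comp e.bijective)
    (fun x y => by rw [map_mul, toAdd_mul])
  refine ⟨ε, hε, hread, fun h i hh => group_spec.2.2.1 ((hread h).trans hh), group_spec.2.2.1 ?_⟩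
  rw [hread, MulEquiv.apply_symm_apply, toAdd_ofAdd, group_spec.2.2.2]

/-- The base type of code `455`, read in `ZMod 6 × ZMod 2`. [folklore] -/
theorem mem_455_iff_enum : ∀ i : Fin 12, mem i 455 = true ↔ enum i ∈ ({((0 : ZMod 6), (0 : ZMod 2)), ((1 : ZMod 6), (0 : ZMod 2)), ((2 : ZMod 6), (0 : ZMod 2)), ((0 : ZMod 6), (1 : ZMod 2)), ((1 : ZMod 6), (1 : ZMod 2)), ((2 : ZMod 6), (1 : ZMod 2))} : Finset (ZMod 6 × ZMod 2)) := by
  decide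

/-- The base type of code `462`, read in `ZMod 6 × ZMod 2`. [folklore] -/
theorem mem_462_iff_enum : ∀ i : Fin 12, mem i 462 = true ↔ enum i ∈ ({((1 : ZMod 6), (0 : ZMod 2)), ((2 : ZMod 6), (0 : ZMod 2)), ((3 : ZMod 6), (0 : ZMod 2)), ((0 : ZMod 6), (1 : ZMod 2)), ((1 : ZMod 6), (1 : ZMod 2)), ((2 : ZMod 6), (1 : ZMod 2))} : Finset (ZMod 6 × ZMod 2)) := by
  decide

/-- The base type of code `469`, read in `ZMod 6 × ZMod 2`. [folklore] -/
theorem mem_469_iff_enum : ∀ i : Fin 12, mem i 469 = true ↔ enum i ∈ ({((0 : ZMod 6), (0 : ZMod 2)), ((2 : ZMod 6), (0 : ZMod 2)), ((4 : ZMod 6), (0 : ZMod 2)), ((0 : ZMod 6), (1 : ZMod 2)), ((1 : ZMod 6), (1 : ZMod 2)), ((2 : ZMod 6), (1 : ZMod 2))} : Finset (ZMod 6 × ZMod 2)) := by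
  decide

/-- **Non-vacuity for the base type of code `455`, type `ℤ/6×ℤ/2`.**  For every two group elements `x, y` at different places (`y ≠ x`,
`y ≠ c·x`) there is a rank-four face with base type `Φ` reading `σ₀ ∘ h ∈ Φ ↔ e h ∈ {((0 : ZMod 6), (0 : ZMod 2)), ((1 : ZMod 6), (0 : ZMod 2)), ((2 : ZMod 6), (0 : ZMod 2)), ((0 : ZMod 6), (1 : ZMod 2)), ((1 : ZMod 6), (1 : ZMod 2)), ((2 : ZMod 6), (1 : ZMod 2))}` and place
representatives `σ₀ ∘ e⁻¹(x)`, `σ₀ ∘ e⁻¹(y)`. [folklore] -/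
theorem exists_face_455_of_mulEquiv (K : CMField) [IsGalois ℚ K] (e : ((K : Type) ≃ₐ[ℚ] (K : Type)) ≃* Multiplicative (ZMod 6 × ZMod 2)) (σ₀ : (K : Type) →+* ℂ)
    (hconj : σ₀.comp ((e.symm (Multiplicative.ofAdd ((3 : ZMod 6), (0 : ZMod 2))) : ((K : Type) ≃ₐ[ℚ] (K : Type))) : (K : Type) →+* (K : Type)) = conjugate σ₀)
    (x y : ZMod 6 × ZMod 2) (hxy : x ≠ y ∧ ((3 : ZMod 6), (0 : ZMod 2)) + x ≠ y) :
    ∃ R : Face K, (∀ h : ((K : Type) ≃ₐ[ℚ] (K : Type)), σ₀.comp (h : (K : Type) →+* (K : Type)) ∈ R.Φ.1 ↔ Multiplicative.toAdd (e h) ∈ ({((0 : ZMod 6), (0 : ZMod 2)), ((1 : ZMod 6), (0 : ZMod 2)), ((2 : ZMod 6), (0 : ZMod 2)), ((0 : ZMod 6), (1 : ZMod 2)), ((1 : ZMod 6), (1 : ZMod 2)), ((2 : ZMod 6), (1 : ZMod 2))} : Finset (ZMod 6 × ZMod 2))) ∧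
      R.p = σ₀.comp ((e.symm (Multiplicative.ofAdd x) : ((K : Type) ≃ₐ[ℚ] (K : Type))) : (K : Type) →+* (K : Type)) ∧ R.p' = σ₀.comp ((e.symm (Multiplicative.ofAdd y) : ((K : Type) ≃ₐ[ℚ] (K : Type))) : (K : Type) →+* (K : Type)) := by
  obtain ⟨ε, hε, hread, hidx, hεc⟩ := exists_autEnum_of_mulEquiv K e
  obtain ⟨e', hmul, he⟩ := FaceCensus.exists_enum_of_autEnum Γ σ₀ ε hε
  have hconj' : e' conjT = Γ.conj := by rw [FaceCensus.conjT_eq_translate σ₀, ← hconj, he, hεc]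
  obtain ⟨R₀, hT₀, -, -⟩ := FaceCensus.exists_face_reads Γ e' hmul hconj' σ₀ (r := (455, 9, 18)) (by decide +kernel)
  have hne : InfinitePlace.mk (σ₀.comp ((e.symm (Multiplicative.ofAdd x) : ((K : Type) ≃ₐ[ℚ] (K : Type))) : (K : Type) →+* (K : Type))) ≠
      InfinitePlace.mk (σ₀.comp ((e.symm (Multiplicative.ofAdd y) : ((K : Type) ≃ₐ[ℚ] (K : Type))) : (K : Type) →+* (K : Type))) := by
    rw [Ne, FaceCensus.mk_comp_eq_mk_comp_iff σ₀ hconj]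
    rintro (h | h)
    · exact hxy.1 (by simpa using congrArg (fun z => Multiplicative.toAdd (e z)) h)
    · refine hxy.2 ?_
      have h2 := congrArg (fun z => Multiplicative.toAdd (e z)) h
      simp only [map_mul, toAdd_mul, MulEquiv.apply_symm_apply, toAdd_ofAdd] at h2
      rw [← h2]
  refine ⟨⟨R₀.Φ, _, _, hne⟩, fun h => ?_, rfl, rfl⟩
  have hk := hT₀.2 (e' (translate σ₀ (σ₀.comp (h : (K : Type) →+* (K : Type)))))
  rw [e'.symm_apply_apply, mem_pullType, translate_apply_self, he] at hk
  rw [← hread h]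
  exact hk.symm.trans (mem_455_iff_enum (ε h))

/-- **Non-vacuity for the base type of code `462`, type `ℤ/6×ℤ/2`.**  For every two group elements `x, y` at different places (`y ≠ x`,
`y ≠ c·x`) there is a rank-four face with base type `Φ` reading `σ₀ ∘ h ∈ Φ ↔ e h ∈ {((1 : ZMod 6), (0 : ZMod 2)), ((2 : ZMod 6), (0 : ZMod 2)), ((3 : ZMod 6), (0 : ZMod 2)), ((0 : ZMod 6), (1 : ZMod 2)), ((1 : ZMod 6), (1 : ZMod 2)), ((2 : ZMod 6), (1 : ZMod 2))}` and place
representatives `σ₀ ∘ e⁻¹(x)`, `σ₀ ∘ e⁻¹(y)`. [folklore] -/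
theorem exists_face_462_of_mulEquiv (K : CMField) [IsGalois ℚ K] (e : ((K : Type) ≃ₐ[ℚ] (K : Type)) ≃* Multiplicative (ZMod 6 × ZMod 2)) (σ₀ : (K : Type) →+* ℂ)
    (hconj : σ₀.comp ((e.symm (Multiplicative.ofAdd ((3 : ZMod 6), (0 : ZMod 2))) : ((K : Type) ≃ₐ[ℚ] (K : Type))) : (K : Type) →+* (K : Type)) = conjugate σ₀)
    (x y : ZMod 6 × ZMod 2) (hxy : x ≠ y ∧ ((3 : ZMod 6), (0 : ZMod 2)) + x ≠ y) :
    ∃ R : Face K, (∀ h : ((K : Type) ≃ₐ[ℚ] (K : Type)), σ₀.comp (h : (K : Type) →+* (K : Type)) ∈ R.Φ.1 ↔ Multiplicative.toAdd (e h) ∈ ({((1 : ZMod 6), (0 : ZMod 2)), ((2 : ZMod 6), (0 : ZMod 2)), ((3 : ZMod 6), (0 : ZMod 2)), ((0 : ZMod 6), (1 : ZMod 2)), ((1 : ZMod 6), (1 : ZMod 2)), ((2 : ZMod 6), (1 : ZMod 2))} : Finset (ZMod 6 × ZMod 2))) ∧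
      R.p = σ₀.comp ((e.symm (Multiplicative.ofAdd x) : ((K : Type) ≃ₐ[ℚ] (K : Type))) : (K : Type) →+* (K : Type)) ∧ R.p' = σ₀.comp ((e.symm (Multiplicative.ofAdd y) : ((K : Type) ≃ₐ[ℚ] (K : Type))) : (K : Type) →+* (K : Type)) := by
  obtain ⟨ε, hε, hread, hidx, hεc⟩ := exists_autEnum_of_mulEquiv K e
  obtain ⟨e', hmul, he⟩ := FaceCensus.exists_enum_of_autEnum Γ σ₀ ε hε
  have hconj' : e' conjT = Γ.conj := by rw [FaceCensus.conjT_eq_translate σ₀, ← hconj, he, hεc]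
  obtain ⟨R₀, hT₀, -, -⟩ := FaceCensus.exists_face_reads Γ e' hmul hconj' σ₀ (r := (462, 18, 2304)) (by decide +kernel)
  have hne : InfinitePlace.mk (σ₀.comp ((e.symm (Multiplicative.ofAdd x) : ((K : Type) ≃ₐ[ℚ] (K : Type))) : (K : Type) →+* (K : Type))) ≠
      InfinitePlace.mk (σ₀.comp ((e.symm (Multiplicative.ofAdd y) : ((K : Type) ≃ₐ[ℚ] (K : Type))) : (K : Type) →+* (K : Type))) := by
    rw [Ne, FaceCensus.mk_comp_eq_mk_comp_iff σ₀ hconj]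
    rintro (h | h)
    · exact hxy.1 (by simpa using congrArg (fun z => Multiplicative.toAdd (e z)) h)
    · refine hxy.2 ?_
      have h2 := congrArg (fun z => Multiplicative.toAdd (e z)) h
      simp only [map_mul, toAdd_mul, MulEquiv.apply_symm_apply, toAdd_ofAdd] at h2
      rw [← h2]
  refine ⟨⟨R₀.Φ, _, _, hne⟩, fun h => ?_, rfl, rfl⟩
  have hk := hT₀.2 (e' (translate σ₀ (σ₀.comp (h : (K : Type) →+* (K : Type)))))
  rw [e'.symm_apply_apply, mem_pullType, translate_apply_self, he] at hk
  rw [← hread h]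
  exact hk.symm.trans (mem_462_iff_enum (ε h))

/-- **Non-vacuity for the base type of code `469`, type `ℤ/6×ℤ/2`.**  For every two group elements `x, y` at different places (`y ≠ x`,
`y ≠ c·x`) there is a rank-four face with base type `Φ` reading `σ₀ ∘ h ∈ Φ ↔ e h ∈ {((0 : ZMod 6), (0 : ZMod 2)), ((2 : ZMod 6), (0 : ZMod 2)), ((4 : ZMod 6), (0 : ZMod 2)), ((0 : ZMod 6), (1 : ZMod 2)), ((1 : ZMod 6), (1 : ZMod 2)), ((2 : ZMod 6), (1 : ZMod 2))}` and place
representatives `σ₀ ∘ e⁻¹(x)`, `σ₀ ∘ e⁻¹(y)`. [folklore] -/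
theorem exists_face_469_of_mulEquiv (K : CMField) [IsGalois ℚ K] (e : ((K : Type) ≃ₐ[ℚ] (K : Type)) ≃* Multiplicative (ZMod 6 × ZMod 2)) (σ₀ : (K : Type) →+* ℂ)
    (hconj : σ₀.comp ((e.symm (Multiplicative.ofAdd ((3 : ZMod 6), (0 : ZMod 2))) : ((K : Type) ≃ₐ[ℚ] (K : Type))) : (K : Type) →+* (K : Type)) = conjugate σ₀)
    (x y : ZMod 6 × ZMod 2) (hxy : x ≠ y ∧ ((3 : ZMod 6), (0 : ZMod 2)) + x ≠ y) :
    ∃ R : Face K, (∀ h : ((K : Type) ≃ₐ[ℚ] (K : Type)), σ₀.comp (h : (K : Type) →+* (K : Type)) ∈ R.Φ.1 ↔ Multiplicative.toAdd (e h) ∈ ({((0 : ZMod 6), (0 : ZMod 2)), ((2 : ZMod 6), (0 : ZMod 2)), ((4 : ZMod 6), (0 : ZMod 2)), ((0 : ZMod 6), (1 : ZMod 2)), ((1 : ZMod 6), (1 : ZMod 2)), ((2 : ZMod 6), (1 : ZMod 2))} : Finset (ZMod 6 × ZMod 2))) ∧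
      R.p = σ₀.comp ((e.symm (Multiplicative.ofAdd x) : ((K : Type) ≃ₐ[ℚ] (K : Type))) : (K : Type) →+* (K : Type)) ∧ R.p' = σ₀.comp ((e.symm (Multiplicative.ofAdd y) : ((K : Type) ≃ₐ[ℚ] (K : Type))) : (K : Type) →+* (K : Type)) := by
  obtain ⟨ε, hε, hread, hidx, hεc⟩ := exists_autEnum_of_mulEquiv K e
  obtain ⟨e', hmul, he⟩ := FaceCensus.exists_enum_of_autEnum Γ σ₀ ε hε
  have hconj' : e' conjT = Γ.conj := by rw [FaceCensus.conjT_eq_translate σ₀, ← hconj, he, hεc]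
  obtain ⟨R₀, hT₀, -, -⟩ := FaceCensus.exists_face_reads Γ e' hmul hconj' σ₀ (r := (469, 9, 1152)) (by decide +kernel)
  have hne : InfinitePlace.mk (σ₀.comp ((e.symm (Multiplicative.ofAdd x) : ((K : Type) ≃ₐ[ℚ] (K : Type))) : (K : Type) →+* (K : Type))) ≠
      InfinitePlace.mk (σ₀.comp ((e.symm (Multiplicative.ofAdd y) : ((K : Type) ≃ₐ[ℚ] (K : Type))) : (K : Type) →+* (K : Type))) := by
    rw [Ne, FaceCensus.mk_comp_eq_mk_comp_iff σ₀ hconj]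
    rintro (h | h)
    · exact hxy.1 (by simpa using congrArg (fun z => Multiplicative.toAdd (e z)) h)
    · refine hxy.2 ?_
      have h2 := congrArg (fun z => Multiplicative.toAdd (e z)) h
      simp only [map_mul, toAdd_mul, MulEquiv.apply_symm_apply, toAdd_ofAdd] at h2
      rw [← h2]
  refine ⟨⟨R₀.Φ, _, _, hne⟩, fun h => ?_, rfl, rfl⟩
  have hk := hT₀.2 (e' (translate σ₀ (σ₀.comp (h : (K : Type) →+* (K : Type)))))
  rw [e'.symm_apply_apply, mem_pullType, translate_apply_self, he] at hk
  rw [← hread h]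
  exact hk.symm.trans (mem_469_iff_enum (ε h))

/-- **FIELD CLOSURE FROM `Gal(K/ℚ) ≃* Multiplicative (ZMod 6 × ZMod 2)`, type `ℤ/6×ℤ/2` — CLOSED, headline.**  `K` a Galois CM field with an isomorphism
`e : Gal(K/ℚ) ≃* Multiplicative (ZMod 6 × ZMod 2)` (so `[K:ℚ] = 12`), `e⁻¹(3,0)` = complex conjugation at `σ₀` (normalise any isomorphism by `exists_mulEquiv_conj`); `σ₀` a base embedding; the 6 faces `R₁`: type `455` ↔ `{(0,0), (1,0), (2,0), (0,1), (1,1), (2,1)}`, places `e⁻¹((0,0))`, `e⁻¹((1,0))`; `R₂`: type `455` ↔ `{(0,0), (1,0), (2,0), (0,1), (1,1), (2,1)}`, places `e⁻¹((0,0))`, `e⁻¹((2,0))`; `R₃`: type `455` ↔ `{(0,0), (1,0), (2,0), (0,1), (1,1), (2,1)}`, places `e⁻¹((0,0))`, `e⁻¹((1,1))`; `R₄`: type `462` ↔ `{(1,0), (2,0), (3,0), (0,1), (1,1), (2,1)}`, places `e⁻¹((1,0))`, `e⁻¹((2,1))`; `R₅`: type `462` ↔ `{(1,0), (2,0), (3,0),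 (0,1), (1,1), (2,1)}`, places `e⁻¹((2,0))`, `e⁻¹((1,1))`; `R₆`: type `469` ↔ `{(0,0), (2,0), (4,0), (0,1), (1,1), (2,1)}`, places `e⁻¹((0,0))`, `e⁻¹((1,1))` (they exist:
`exists_face_<code>_of_mulEquiv`).  ONE period witness for each on the universe of record implies the Hodge conjecture, in every codimension,
for every complex abelian variety dominated by a finite product of abelian varieties realising CM types of CM fields embeddable in `K`.  No
enumeration, table or conjugation-index hypothesis is left (`exists_autEnum_of_mulEquiv`).  (FRAMING: conditional on these 6 face periods;
`HC_CM` is NOT proved.) [cite: Shimura1998, §6.2 Theorem 3 and §6.1 Corollary of Theorem 2 (pp. 41–43)] [cite: Pohlmann1968, Thm. 1]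
[cite: Milne1999LefschetzClasses, Thm. 3.2 and Cor. 4.5] [cite: MumfordAV1970, §19 Thm. 1 and p. 169] -/
theorem hodgeConjectureFor_of_avDominatedBy_isProductOf_of_facePeriod_duodecicC6C2_mulEquiv (K : CMField) [IsGalois ℚ K]
    (e : ((K : Type) ≃ₐ[ℚ] (K : Type)) ≃* Multiplicative (ZMod 6 × ZMod 2)) (σ₀ : (K : Type) →+* ℂ)
    (hconj : σ₀.comp ((e.symm (Multiplicative.ofAdd ((3 : ZMod 6), (0 : ZMod 2))) : ((K : Type) ≃ₐ[ℚ] (K : Type))) : (K : Type) →+* (K : Type)) = conjugate σ₀) (R₁ R₂ R₃ R₄ R₅ R₆ : Face K)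
    (hΦ₁ : ∀ h : ((K : Type) ≃ₐ[ℚ] (K : Type)), σ₀.comp (h : (K : Type) →+* (K : Type)) ∈ R₁.Φ.1 ↔ Multiplicative.toAdd (e h) ∈ ({((0 : ZMod 6), (0 : ZMod 2)), ((1 : ZMod 6), (0 : ZMod 2)), ((2 : ZMod 6), (0 : ZMod 2)), ((0 : ZMod 6), (1 : ZMod 2)), ((1 : ZMod 6), (1 : ZMod 2)), ((2 : ZMod 6), (1 : ZMod 2))} : Finset (ZMod 6 × ZMod 2)))
    (hp₁ : R₁.p = σ₀.comp ((e.symm (Multiplicative.ofAdd ((0 : ZMod 6), (0 : ZMod 2))) : ((K : Type) ≃ₐ[ℚ] (K : Type))) : (K : Type) →+* (K : Type)))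
    (hq₁ : R₁.p' = σ₀.comp ((e.symm (Multiplicative.ofAdd ((1 : ZMod 6), (0 : ZMod 2))) : ((K : Type) ≃ₐ[ℚ] (K : Type))) : (K : Type) →+* (K : Type)))
    (hΦ₂ : ∀ h : ((K : Type) ≃ₐ[ℚ] (K : Type)), σ₀.comp (h : (K : Type) →+* (K : Type)) ∈ R₂.Φ.1 ↔ Multiplicative.toAdd (e h) ∈ ({((0 : ZMod 6), (0 : ZMod 2)), ((1 : ZMod 6), (0 : ZMod 2)), ((2 : ZMod 6), (0 : ZMod 2)), ((0 : ZMod 6), (1 : ZMod 2)), ((1 : ZMod 6), (1 : ZMod 2)), ((2 : ZMod 6), (1 : ZMod 2))} : Finset (ZMod 6 × ZMod 2)))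
    (hp₂ : R₂.p = σ₀.comp ((e.symm (Multiplicative.ofAdd ((0 : ZMod 6), (0 : ZMod 2))) : ((K : Type) ≃ₐ[ℚ] (K : Type))) : (K : Type) →+* (K : Type)))
    (hq₂ : R₂.p' = σ₀.comp ((e.symm (Multiplicative.ofAdd ((2 : ZMod 6), (0 : ZMod 2))) : ((K : Type) ≃ₐ[ℚ] (K : Type))) : (K : Type) →+* (K : Type)))
    (hΦ₃ : ∀ h : ((K : Type) ≃ₐ[ℚ] (K : Type)), σ₀.comp (h : (K : Type) →+* (K : Type)) ∈ R₃.Φ.1 ↔ Multiplicative.toAdd (e h) ∈ ({((0 : ZMod 6), (0 : ZMod 2)), ((1 : ZMod 6), (0 : ZMod 2)), ((2 : ZMod 6), (0 : ZMod 2)), ((0 : ZMod 6), (1 : ZMod 2)), ((1 : ZMod 6), (1 : ZMod 2)), ((2 : ZMod 6), (1 : ZMod 2))} : Finset (ZMod 6 × ZMod 2)))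
    (hp₃ : R₃.p = σ₀.comp ((e.symm (Multiplicative.ofAdd ((0 : ZMod 6), (0 : ZMod 2))) : ((K : Type) ≃ₐ[ℚ] (K : Type))) : (K : Type) →+* (K : Type)))
    (hq₃ : R₃.p' = σ₀.comp ((e.symm (Multiplicative.ofAdd ((1 : ZMod 6), (1 : ZMod 2))) : ((K : Type) ≃ₐ[ℚ] (K : Type))) : (K : Type) →+* (K : Type)))
    (hΦ₄ : ∀ h : ((K : Type) ≃ₐ[ℚ] (K : Type)), σ₀.comp (h : (K : Type) →+* (K : Type)) ∈ R₄.Φ.1 ↔ Multiplicative.toAdd (e h) ∈ ({((1 : ZMod 6), (0 : ZMod 2)), ((2 : ZMod 6), (0 : ZMod 2)), ((3 : ZMod 6), (0 : ZMod 2)), ((0 : ZMod 6), (1 : ZMod 2)), ((1 : ZMod 6), (1 : ZMod 2)), ((2 : ZMod 6), (1 : ZMod 2))} : Finset (ZMod 6 × ZMod 2)))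
    (hp₄ : R₄.p = σ₀.comp ((e.symm (Multiplicative.ofAdd ((1 : ZMod 6), (0 : ZMod 2))) : ((K : Type) ≃ₐ[ℚ] (K : Type))) : (K : Type) →+* (K : Type)))
    (hq₄ : R₄.p' = σ₀.comp ((e.symm (Multiplicative.ofAdd ((2 : ZMod 6), (1 : ZMod 2))) : ((K : Type) ≃ₐ[ℚ] (K : Type))) : (K : Type) →+* (K : Type)))
    (hΦ₅ : ∀ h : ((K : Type) ≃ₐ[ℚ] (K : Type)), σ₀.comp (h : (K : Type) →+* (K : Type)) ∈ R₅.Φ.1 ↔ Multiplicative.toAdd (e h) ∈ ({((1 : ZMod 6), (0 : ZMod 2)), ((2 : ZMod 6), (0 : ZMod 2)), ((3 : ZMod 6), (0 : ZMod 2)), ((0 : ZMod 6), (1 : ZMod 2)), ((1 : ZMod 6), (1 : ZMod 2)), ((2 : ZMod 6), (1 : ZMod 2))} : Finset (ZMod 6 × ZMod 2)))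
    (hp₅ : R₅.p = σ₀.comp ((e.symm (Multiplicative.ofAdd ((2 : ZMod 6), (0 : ZMod 2))) : ((K : Type) ≃ₐ[ℚ] (K : Type))) : (K : Type) →+* (K : Type)))
    (hq₅ : R₅.p' = σ₀.comp ((e.symm (Multiplicative.ofAdd ((1 : ZMod 6), (1 : ZMod 2))) : ((K : Type) ≃ₐ[ℚ] (K : Type))) : (K : Type) →+* (K : Type)))
    (hΦ₆ : ∀ h : ((K : Type) ≃ₐ[ℚ] (K : Type)), σ₀.comp (h : (K : Type) →+* (K : Type)) ∈ R₆.Φ.1 ↔ Multiplicative.toAdd (e h) ∈ ({((0 : ZMod 6), (0 : ZMod 2)), ((2 : ZMod 6), (0 : ZMod 2)), ((4 : ZMod 6), (0 : ZMod 2)), ((0 : ZMod 6), (1 : ZMod 2)), ((1 : ZMod 6), (1 : ZMod 2)), ((2 : ZMod 6), (1 : ZMod 2))} : Finset (ZMod 6 × ZMod 2)))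
    (hp₆ : R₆.p = σ₀.comp ((e.symm (Multiplicative.ofAdd ((0 : ZMod 6), (0 : ZMod 2))) : ((K : Type) ≃ₐ[ℚ] (K : Type))) : (K : Type) →+* (K : Type)))
    (hq₆ : R₆.p' = σ₀.comp ((e.symm (Multiplicative.ofAdd ((1 : ZMod 6), (1 : ZMod 2))) : ((K : Type) ≃ₐ[ℚ] (K : Type))) : (K : Type) →+* (K : Type)))
    (h₁ : ∃ ι₁ : K →+* ℂ, R₁.Admissible ι₁ ∧ ∃ (V : HermSpace3 K ι₁) (σ : K →+* ℂ),
      (Model.picardCMUniverse exists_isReal_hodgeModel_holds hodgePQ_independent_of_hodgeModel_holds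
        BallQuotient.ballQuotientUniformised_holds cmAbelianVarietyRealised_holds).PeriodNV ι₁ V K R₁.psi σ)
    (h₂ : ∃ ι₁ : K →+* ℂ, R₂.Admissible ι₁ ∧ ∃ (V : HermSpace3 K ι₁) (σ : K →+* ℂ),
      (Model.picardCMUniverse exists_isReal_hodgeModel_holds hodgePQ_independent_of_hodgeModel_holds
        BallQuotient.ballQuotientUniformised_holds cmAbelianVarietyRealised_holds).PeriodNV ι₁ V K R₂.psi σ)
    (h₃ : ∃ ι₁ : K →+* ℂ, R₃.Admissible ι₁ ∧ ∃ (V : HermSpace3 K ι₁) (σ : K →+* ℂ),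
      (Model.picardCMUniverse exists_isReal_hodgeModel_holds hodgePQ_independent_of_hodgeModel_holds
        BallQuotient.ballQuotientUniformised_holds cmAbelianVarietyRealised_holds).PeriodNV ι₁ V K R₃.psi σ)
    (h₄ : ∃ ι₁ : K →+* ℂ, R₄.Admissible ι₁ ∧ ∃ (V : HermSpace3 K ι₁) (σ : K →+* ℂ),
      (Model.picardCMUniverse exists_isReal_hodgeModel_holds hodgePQ_independent_of_hodgeModel_holds
        BallQuotient.ballQuotientUniformised_holds cmAbelianVarietyRealised_holds).PeriodNV ι₁ V K R₄.psi σ)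
    (h₅ : ∃ ι₁ : K →+* ℂ, R₅.Admissible ι₁ ∧ ∃ (V : HermSpace3 K ι₁) (σ : K →+* ℂ),
      (Model.picardCMUniverse exists_isReal_hodgeModel_holds hodgePQ_independent_of_hodgeModel_holds
        BallQuotient.ballQuotientUniformised_holds cmAbelianVarietyRealised_holds).PeriodNV ι₁ V K R₅.psi σ)
    (h₆ : ∃ ι₁ : K →+* ℂ, R₆.Admissible ι₁ ∧ ∃ (V : HermSpace3 K ι₁) (σ : K →+* ℂ),
      (Model.picardCMUniverse exists_isReal_hodgeModel_holds hodgePQ_independent_of_hodgeModel_holds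
        BallQuotient.ballQuotientUniformised_holds cmAbelianVarietyRealised_holds).PeriodNV ι₁ V K R₆.psi σ)
    {P A : AbelianVariety ℂ} (hP : AbelianVariety.IsProductOf (fun B : AbelianVariety ℂ =>
      ∃ (E : Type) (_ : Field E) (_ : NumberField E) (_ : IsCMField E) (_ : E →+* (K : Type)) (Φ : CMType E)
        (ι : 𝓞 E →+* End B) (θ : E →+* Module.End ℂ (complexBetti B.X 1)),
        IsCMTypeRealisation Φ B ι θ) P)
    (hA : AVDominatedBy A P) : HodgeConjectureFor A.dim A.X := by
  obtain ⟨ε, hε, hread, hidx, hεc⟩ := exists_autEnum_of_mulEquiv K e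
  refine hodgeConjectureFor_of_avDominatedBy_isProductOf_of_facePeriod_duodecicC6C2_aut K σ₀ ε hε _ hconj hεc R₁ R₂ R₃ R₄ R₅ R₆
    (e.symm (Multiplicative.ofAdd ((0 : ZMod 6), (0 : ZMod 2)))) (e.symm (Multiplicative.ofAdd ((1 : ZMod 6), (0 : ZMod 2))))
    (e.symm (Multiplicative.ofAdd ((0 : ZMod 6), (0 : ZMod 2)))) (e.symm (Multiplicative.ofAdd ((2 : ZMod 6), (0 : ZMod 2))))
    (e.symm (Multiplicative.ofAdd ((0 : ZMod 6), (0 : ZMod 2)))) (e.symm (Multiplicative.ofAdd ((1 : ZMod 6), (1 : ZMod 2))))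
    (e.symm (Multiplicative.ofAdd ((1 : ZMod 6), (0 : ZMod 2)))) (e.symm (Multiplicative.ofAdd ((2 : ZMod 6), (1 : ZMod 2))))
    (e.symm (Multiplicative.ofAdd ((2 : ZMod 6), (0 : ZMod 2)))) (e.symm (Multiplicative.ofAdd ((1 : ZMod 6), (1 : ZMod 2))))
    (e.symm (Multiplicative.ofAdd ((0 : ZMod 6), (0 : ZMod 2)))) (e.symm (Multiplicative.ofAdd ((1 : ZMod 6), (1 : ZMod 2))))
    ?_ ?_ ?_ ?_ ?_ ?_ ?_ ?_ ?_ ?_ ?_ ?_ ?_ ?_ ?_ ?_ ?_ ?_ ?_ ?_ ?_ ?_ ?_ ?_ ?_ ?_ ?_ ?_ ?_ ?_ h₁ h₂ h₃ h₄ h₅ h₆ hP hA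
  · intro h
    rw [hΦ₁, ← hread h]
    exact (mem_455_iff_enum (ε h)).symm
  · exact hp₁
  · rw [hidx _ 0 (by rw [MulEquiv.apply_symm_apply, toAdd_ofAdd]; decide)]; decide
  · exact hq₁
  · rw [hidx _ 1 (by rw [MulEquiv.apply_symm_apply, toAdd_ofAdd]; decide)]; decide
  · intro h
    rw [hΦ₂, ← hread h]
    exact (mem_455_iff_enum (ε h)).symm
  · exact hp₂
  · rw [hidx _ 0 (by rw [MulEquiv.apply_symm_apply, toAdd_ofAdd]; decide)]; decide
  · exact hq₂
  · rw [hidx _ 2 (by rw [MulEquiv.apply_symm_apply, toAdd_ofAdd]; decide)]; decide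
  · intro h
    rw [hΦ₃, ← hread h]
    exact (mem_455_iff_enum (ε h)).symm
  · exact hp₃
  · rw [hidx _ 0 (by rw [MulEquiv.apply_symm_apply, toAdd_ofAdd]; decide)]; decide
  · exact hq₃
  · rw [hidx _ 7 (by rw [MulEquiv.apply_symm_apply, toAdd_ofAdd]; decide)]; decide
  · intro h
    rw [hΦ₄, ← hread h]
    exact (mem_462_iff_enum (ε h)).symm
  · exact hp₄
  · rw [hidx _ 1 (by rw [MulEquiv.apply_symm_apply, toAdd_ofAdd]; decide)]; decide
  · exact hq₄
  · rw [hidx _ 8 (by rw [MulEquiv.apply_symm_apply, toAdd_ofAdd]; decide)]; decide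
  · intro h
    rw [hΦ₅, ← hread h]
    exact (mem_462_iff_enum (ε h)).symm
  · exact hp₅
  · rw [hidx _ 2 (by rw [MulEquiv.apply_symm_apply, toAdd_ofAdd]; decide)]; decide
  · exact hq₅
  · rw [hidx _ 7 (by rw [MulEquiv.apply_symm_apply, toAdd_ofAdd]; decide)]; decide
  · intro h
    rw [hΦ₆, ← hread h]
    exact (mem_469_iff_enum (ε h)).symm
  · exact hp₆
  · rw [hidx _ 0 (by rw [MulEquiv.apply_symm_apply, toAdd_ofAdd]; decide)]; decide
  · exact hq₆
  · rw [hidx _ 7 (by rw [MulEquiv.apply_symm_apply, toAdd_ofAdd]; decide)]; decide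

end Summit.HodgeConjecture.CorCM.DuodecicFaceTransport.C6C2


/-! ## Normalising a given isomorphism `Gal(K/ℚ) ≃* ℤ/6×ℤ/2`: complex conjugation can be put at `(3,0)` -/

namespace Summit.HodgeConjecture.CorCM.FaceCensus

/-- `ZMod 6 × ZMod 2`: the involutions are `(3,0)`, `(0,1)`, `(3,1)`. [folklore] -/
theorem zmod_six_two_involution :
    ∀ x : ZMod 6 × ZMod 2, x ≠ 0 → x + x = 0 → x = (3, 0) ∨ x = (0, 1) ∨ x = (3, 1) := by decide

/-- `ZMod 6 × ZMod 2`: each involution is carried to `(3,0)` by an additive bijection (`(a,b) ↦ (4a+3b, a mod 2)`, resp.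
`(a,b) ↦ (a, b + a mod 2)`, resp. the identity). [folklore] -/
theorem zmod_six_two_normalise (v : ZMod 6 × ZMod 2) (hv : v = (3, 0) ∨ v = (0, 1) ∨ v = (3, 1)) :
    ∃ ψ : ZMod 6 × ZMod 2 → ZMod 6 × ZMod 2, Function.Bijective ψ ∧ (∀ x y, ψ (x + y) = ψ x + ψ y) ∧ ψ v = (3, 0) := by
  rcases hv with rfl | rfl | rfl
  · exact ⟨fun x => x, Function.bijective_id, fun _ _ => rfl, rfl⟩
  · exact ⟨fun x => (4 * x.1 + 3 * (x.2.val : ZMod 6), (x.1.val : ZMod 2)), by decide, by decide, by decide⟩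
  · exact ⟨fun x => (x.1, x.2 + (x.1.val : ZMod 2)), by decide, by decide, by decide⟩

variable (K : CMField) [IsGalois ℚ K] (σ₀ : (K : Type) →+* ℂ)

/-- **Normalisation for `Gal(K/ℚ) ≃* ℤ/6×ℤ/2`.**  For ANY isomorphism `e₀ : Gal(K/ℚ) ≃* Multiplicative (ZMod 6 × ZMod 2)` of a Galois CM
field there is one, `e`, with `e⁻¹(3,0)` inducing complex conjugation at `σ₀` (the hypothesis of
`DuodecicFaceTransport.C6C2.…_mulEquiv`): complex conjugation reads an involution, and the three involutions are exchanged by additive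
bijections (`zmod_six_two_involution`, `zmod_six_two_normalise`, `exists_mulEquiv_of_bijective`). [folklore] -/
theorem exists_mulEquiv_conj_zmod_six_two (e₀ : ((K : Type) ≃ₐ[ℚ] (K : Type)) ≃* Multiplicative (ZMod 6 × ZMod 2)) :
    ∃ e : ((K : Type) ≃ₐ[ℚ] (K : Type)) ≃* Multiplicative (ZMod 6 × ZMod 2),
      σ₀.comp ((e.symm (Multiplicative.ofAdd ((3 : ZMod 6), (0 : ZMod 2))) : ((K : Type) ≃ₐ[ℚ] (K : Type))) : (K : Type) →+* (K : Type)) = conjugate σ₀ := by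
  obtain ⟨c, hc⟩ := exists_conjAut σ₀
  obtain ⟨h0, h2⟩ := involution_of_map_add (fun x => Multiplicative.toAdd (e₀ x))
    (Multiplicative.toAdd.injective.comp e₀.injective) (fun x y => by rw [map_mul, toAdd_mul])
    (conjAut_mul_self σ₀ hc) (conjAut_ne_one σ₀ hc)
  obtain ⟨ψ, hψ, hψadd, hψv⟩ := zmod_six_two_normalise _ (zmod_six_two_involution _ h0 h2)
  obtain ⟨e, he⟩ := exists_mulEquiv_of_bijective (fun x => ψ (Multiplicative.toAdd (e₀ x)))
    (hψ.comp (Multiplicative.toAdd.bijective.comp e₀.bijective)) (fun x y => by rw [map_mul, toAdd_mul, hψadd])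
  refine ⟨e, ?_⟩
  have hec : e c = Multiplicative.ofAdd ((3 : ZMod 6), (0 : ZMod 2)) := by
    rw [← ofAdd_toAdd (e c), he]; exact congrArg _ hψv
  rw [← hec, MulEquiv.symm_apply_apply]; exact hc

end Summit.HodgeConjecture.CorCM.FaceCensus

end
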